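import Summits.AtomisticToContinuum.HydrodynamicLimit.Theses.AntiMazurCoboundaries
import Literature.MathematicalPhysics.KineticTheory.HardSphereEulerProofs
import Literature.Analysis.FluidPDE.LocalForecastCorrector

/-!
# `LocalCertificateTransfer`: the corrector normal form of `CorrectorPressureDecay`

Route `AntiMazurCoboundaries` of `AtomisticToContinuum/HydrodynamicLimit`, support item
stmt-AtomisticToContinuum-13917 (`LocalCertificateTransfer :
InfluenceLocality → CellForecastPressureDecay → CorrectorPressureDecay`). Helper lemmas
(`--supports`), landing the N- and cell-free bookkeeping of the transfer plan once and for all: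

* `lintegral_exp_cost_le` — the COST CLAUSE (plan step (8)): under a probability law, a corrector with
  `|W| ≤ B` has `∫ exp(4 h⁻¹ |W|) ≤ e^E` as soon as `4B ≤ E·h`.
* `correctorPressureDecay_of_boundedCorrector` — `CorrectorPressureDecay` follows from a DEFECT-ONLY
  statement for measurable correctors obeying the kinetic sup bound `|W| ≤ B·(N+1)·ℓ_N`
  (`ℓ_N = (N+1)^{-1/3}`, `B` chosen after `δ`, before `N`): the first conjunct of the crux
  (`G_N` is a probability measure, `isProbabilityMeasure_localGibbsLaw`, `σ ≤ 1/2`) and the cost clause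
  (with `τ₀ := 4B/δ + 1`) are discharged here, so that ANY proof of the crux through bounded kinetic
  correctors only owes the defect bound `∫ exp(2(F − lag⁻¹(W∘Φ_lag − W))) dG_N ≤ e^{δ(N+1)}`.
* `correctorPressureDecay_of_localForecastDefect` — the same with the route's WITNESS plugged in
  (plan step (1)): `W = localForecastCorrector Ψ (Rℓ_N) (Tℓ_N) f` (tree definition, bounded by
  `(N+1)·κTℓ_N/2` via `abs_localForecastCorrector_le`, measurable via
  `measurable_localForecastCorrector_torus`), `f(x,v) = φ(x) g((v − u₀)/√θ)`, lag `λℓ_N`; the remaining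
  obligation is exactly the defect pressure bound of the Fejér local forecast corrector (plan steps
  (2)–(7)), with `T, λ, R` chosen after `δ` and the cluster flows `Ψ` after `Φ`.

References: Kipnis–Landim, *Scaling Limits of Interacting Particle Systems* (1999), Ch. 7 §2–3 (corrector /
block reduction); the route docstring of stmt-AtomisticToContinuum-13917.
-/

noncomputable section

open MeasureTheory Set
open scoped ENNReal

namespace Summit.AtomisticToContinuum.HydrodynamicLimit.Theorems

open Literature.MathematicalPhysics.KineticTheory (T3 V3 hsDiameter localGibbsLaw
  isProbabilityMeasure_localGibbsLaw)
open Literature.Analysis.FluidPDE (HardSphereFlow Config localForecastCorrector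
  abs_localForecastCorrector_le measurable_localForecastCorrector_torus)
open Summit.AtomisticToContinuum.HydrodynamicLimit.Theses.AntiMazurCoboundaries (CorrectorPressureDecay)

namespace LocalCertificateTransfer

/-- **Cost clause.** Under a probability law `μ`, a corrector with `|W| ≤ B` pointwise satisfies
`∫ exp(4 h⁻¹ |W|) dμ ≤ e^E` whenever `0 < h` and `4B ≤ E·h`. [folklore] -/
theorem lintegral_exp_cost_le {X : Type*} [MeasurableSpace X] (μ : Measure X) [IsProbabilityMeasure μ]
    {W : X → ℝ} {h B E : ℝ} (hh : 0 < h) (hW : ∀ z, |W z| ≤ B) (hBE : 4 * B ≤ E * h) :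
    ∫⁻ z, ENNReal.ofReal (Real.exp (4 * h⁻¹ * |W z|)) ∂μ ≤ ENNReal.ofReal (Real.exp E) := by
  have hpt : ∀ z, 4 * h⁻¹ * |W z| ≤ E := by
    intro z
    have h1 : 4 * h⁻¹ * |W z| ≤ 4 * h⁻¹ * B :=
      mul_le_mul_of_nonneg_left (hW z) (by positivity)
    have h2 : 4 * h⁻¹ * B ≤ E := by
      rw [mul_comm 4 h⁻¹, mul_assoc, inv_mul_le_iff₀ hh, mul_comm h E]
      exact hBE
    exact h1.trans h2
  calc ∫⁻ z, ENNReal.ofReal (Real.exp (4 * h⁻¹ * |W z|)) ∂μ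
      ≤ ∫⁻ _z, ENNReal.ofReal (Real.exp E) ∂μ :=
        lintegral_mono fun z => ENNReal.ofReal_le_ofReal (Real.exp_le_exp.2 (hpt z))
    _ = ENNReal.ofReal (Real.exp E) := by rw [lintegral_const, measure_univ, mul_one]

/-- **`CorrectorPressureDecay` from a defect-only statement for bounded kinetic correctors.** If for
all data there are, after `δ`, a constant `B ≥ 0` and a threshold `N₀` such that for `N ≥ N₀` and every
flow `Φ` some lag and some measurable corrector with `|W| ≤ B·(N+1)·(N+1)^{-1/3}` have defect pressure
`≤ e^{δ(N+1)}` under `G_N`, then the crux `CorrectorPressureDecay` holds: its first conjunct is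
`isProbabilityMeasure_localGibbsLaw` (`σ < σ₀ ≤ 1/2`) and its cost clause holds with
`τ₀ := 4B/δ + 1` (`lintegral_exp_cost_le`). [folklore] -/
theorem correctorPressureDecay_of_boundedCorrector
    (h : ∀ (a θ : ℝ) (u₀ : V3), 0 < a → 0 < θ → ∃ σ₀ : ℝ, 0 < σ₀ ∧ σ₀ ≤ 1 / 2 ∧ ∀ σ : ℝ,
      0 < σ → σ < σ₀ → ∃ κ : ℝ, 0 < κ ∧ ∀ (φ : T3 → ℝ) (g : V3 → ℝ), Continuous φ → Continuous g →
        (∀ x, |φ x| ≤ 1) → (∀ v, |g v| ≤ κ) →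
        (∀ (c₀ c₂ : ℝ) (b : V3),
          ∫ v, g v * (c₀ + inner ℝ b v + c₂ * ‖v‖ ^ 2) ∂(ProbabilityTheory.stdGaussian V3) = 0) →
        ∀ δ : ℝ, 0 < δ → ∃ B : ℝ, 0 ≤ B ∧ ∃ N₀ : ℕ, ∀ N : ℕ, N₀ ≤ N →
          ∀ Φ : HardSphereFlow (Literature.Analysis.FluidPDE.Torus.geometry (Fin 3)) (hsDiameter σ N) (N + 1),
            ∃ lag : ℝ, 0 < lag ∧ ∃ W : Config (N + 1) (Fin 3) T3 → ℝ, Measurable W ∧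
              (∀ z, |W z| ≤ B * ((N + 1 : ℕ) : ℝ) * ((N + 1 : ℕ) : ℝ) ^ (-(1 / 3 : ℝ))) ∧
              ∫⁻ z, ENNReal.ofReal (Real.exp (2 * ((∑ i, φ (z i).1 * g ((Real.sqrt θ)⁻¹ • ((z i).2 - u₀))) -
                lag⁻¹ * (W (Φ.flow lag z) - W z))))
                  ∂(localGibbsLaw σ (fun _ => a) (fun _ => u₀) (fun _ => θ) N Φ)
                ≤ ENNReal.ofReal (Real.exp (δ * (N + 1)))) :
    CorrectorPressureDecay := by
  intro a θ u₀ ha hθ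
  obtain ⟨σ₀, hσ₀, hσhalf, hσ⟩ := h a θ u₀ ha hθ
  refine ⟨σ₀, hσ₀, fun σ hs hs' => ⟨fun N Φ => ?_, ?_⟩⟩
  · exact isProbabilityMeasure_localGibbsLaw continuous_const continuous_const continuous_const
      (fun _ => ha) (fun _ => hθ) (hs'.le.trans hσhalf) N Φ
  obtain ⟨κ, hκ, hκ'⟩ := hσ σ hs hs'
  refine ⟨κ, hκ, fun φ g hφ hg hφ1 hgκ horth δ hδ => ?_⟩
  obtain ⟨B, hB, N₀, hN⟩ := hκ' φ g hφ hg hφ1 hgκ horth δ hδ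
  refine ⟨4 * B / δ + 1, by positivity, N₀, fun N hNN Φ => ?_⟩
  obtain ⟨lag, hlag, W, hWm, hWB, hdef⟩ := hN N hNN Φ
  refine ⟨lag, hlag, W, hWm, ⟨_, hWB⟩, hdef, ?_⟩
  haveI : IsProbabilityMeasure (localGibbsLaw σ (fun _ => a) (fun _ => u₀) (fun _ => θ) N Φ) :=
    isProbabilityMeasure_localGibbsLaw continuous_const continuous_const continuous_const
      (fun _ => ha) (fun _ => hθ) (hs'.le.trans hσhalf) N Φ
  set ℓ : ℝ := ((N + 1 : ℕ) : ℝ) ^ (-(1 / 3 : ℝ)) with hℓdef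
  have hℓ : 0 < ℓ := Real.rpow_pos_of_pos (Nat.cast_pos.mpr (Nat.succ_pos N)) _
  have hτ₀ : 0 < 4 * B / δ + 1 := by positivity
  have hh : 0 < (4 * B / δ + 1) * ℓ := mul_pos hτ₀ hℓ
  have hN1 : ((N + 1 : ℕ) : ℝ) = (N : ℝ) + 1 := by push_cast; ring
  refine lintegral_exp_cost_le _ hh hWB ?_
  -- `4 · (B (N+1) ℓ) ≤ δ (N+1) · ((4B/δ + 1) ℓ)` since `4B ≤ δ (4B/δ + 1) = 4B + δ`
  have hkey : 4 * B ≤ δ * (4 * B / δ + 1) := by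
    rw [mul_add, mul_div_cancel₀ _ hδ.ne', mul_one]
    linarith
  have hN0 : (0 : ℝ) ≤ (N : ℝ) + 1 := by positivity
  calc 4 * (B * ((N + 1 : ℕ) : ℝ) * ℓ) = (4 * B) * (((N : ℝ) + 1) * ℓ) := by rw [hN1]; ring
    _ ≤ (δ * (4 * B / δ + 1)) * (((N : ℝ) + 1) * ℓ) :=
        mul_le_mul_of_nonneg_right hkey (mul_nonneg hN0 hℓ.le)
    _ = δ * ((N : ℝ) + 1) * ((4 * B / δ + 1) * ℓ) := by ring

/-- **`CorrectorPressureDecay` from the defect bound of the Fejér LOCAL FORECAST corrector** (the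
route's witness, plan step (1) of stmt-AtomisticToContinuum-13917): if, after `δ`, there are a kinetic
horizon `T > 0`, a kinetic lag `λ > 0`, a range `R` and a threshold `N₀` such that for `N ≥ N₀`, every
flow `Φ` and SOME family `Ψ` of cluster flows the corrector
`W = localForecastCorrector Ψ (Rℓ_N) (Tℓ_N) f`, `f(x, v) = φ(x) g((v − u₀)/√θ)`, `ℓ_N = (N+1)^{-1/3}`,
has defect pressure `≤ e^{δ(N+1)}` at lag `λℓ_N`, then `CorrectorPressureDecay` holds (`W` is measurable,
`measurable_localForecastCorrector_torus`, and `|W| ≤ (κT/2)(N+1)ℓ_N`, `abs_localForecastCorrector_le`;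
conclude by `correctorPressureDecay_of_boundedCorrector` with `B = κT/2`). [folklore] -/
theorem correctorPressureDecay_of_localForecastDefect
    (h : ∀ (a θ : ℝ) (u₀ : V3), 0 < a → 0 < θ → ∃ σ₀ : ℝ, 0 < σ₀ ∧ σ₀ ≤ 1 / 2 ∧ ∀ σ : ℝ,
      0 < σ → σ < σ₀ → ∃ κ : ℝ, 0 < κ ∧ ∀ (φ : T3 → ℝ) (g : V3 → ℝ), Continuous φ → Continuous g →
        (∀ x, |φ x| ≤ 1) → (∀ v, |g v| ≤ κ) →
        (∀ (c₀ c₂ : ℝ) (b : V3),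
          ∫ v, g v * (c₀ + inner ℝ b v + c₂ * ‖v‖ ^ 2) ∂(ProbabilityTheory.stdGaussian V3) = 0) →
        ∀ δ : ℝ, 0 < δ → ∃ T : ℝ, 0 < T ∧ ∃ lam : ℝ, 0 < lam ∧ ∃ R : ℝ, ∃ N₀ : ℕ, ∀ N : ℕ, N₀ ≤ N →
          ∀ Φ : HardSphereFlow (Literature.Analysis.FluidPDE.Torus.geometry (Fin 3)) (hsDiameter σ N) (N + 1),
            ∃ Ψ : (k : ℕ) →
              HardSphereFlow (Literature.Analysis.FluidPDE.Torus.geometry (Fin 3)) (hsDiameter σ N) k,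
              ∫⁻ z, ENNReal.ofReal (Real.exp (2 * ((∑ i, φ (z i).1 * g ((Real.sqrt θ)⁻¹ • ((z i).2 - u₀))) -
                (lam * ((N + 1 : ℕ) : ℝ) ^ (-(1 / 3 : ℝ)))⁻¹ *
                  (localForecastCorrector Ψ (R * ((N + 1 : ℕ) : ℝ) ^ (-(1 / 3 : ℝ)))
                      (T * ((N + 1 : ℕ) : ℝ) ^ (-(1 / 3 : ℝ)))
                      (fun q : T3 × V3 => φ q.1 * g ((Real.sqrt θ)⁻¹ • (q.2 - u₀)))
                      (Φ.flow (lam * ((N + 1 : ℕ) : ℝ) ^ (-(1 / 3 : ℝ))) z) -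
                    localForecastCorrector Ψ (R * ((N + 1 : ℕ) : ℝ) ^ (-(1 / 3 : ℝ)))
                      (T * ((N + 1 : ℕ) : ℝ) ^ (-(1 / 3 : ℝ)))
                      (fun q : T3 × V3 => φ q.1 * g ((Real.sqrt θ)⁻¹ • (q.2 - u₀))) z))))
                  ∂(localGibbsLaw σ (fun _ => a) (fun _ => u₀) (fun _ => θ) N Φ)
                ≤ ENNReal.ofReal (Real.exp (δ * (N + 1)))) :
    CorrectorPressureDecay := by
  refine correctorPressureDecay_of_boundedCorrector fun a θ u₀ ha hθ => ?_
  obtain ⟨σ₀, hσ₀, hσhalf, hσ⟩ := h a θ u₀ ha hθ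
  refine ⟨σ₀, hσ₀, hσhalf, fun σ hs hs' => ?_⟩
  obtain ⟨κ, hκ, hκ'⟩ := hσ σ hs hs'
  refine ⟨κ, hκ, fun φ g hφ hg hφ1 hgκ horth δ hδ => ?_⟩
  obtain ⟨T, hT, lam, hlam, R, N₀, hN⟩ := hκ' φ g hφ hg hφ1 hgκ horth δ hδ
  refine ⟨κ * T / 2, by positivity, N₀, fun N hNN Φ => ?_⟩
  obtain ⟨Ψ, hdef⟩ := hN N hNN Φ
  set ℓ : ℝ := ((N + 1 : ℕ) : ℝ) ^ (-(1 / 3 : ℝ)) with hℓdef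
  have hℓ : 0 < ℓ := Real.rpow_pos_of_pos (Nat.cast_pos.mpr (Nat.succ_pos N)) _
  set f : T3 × V3 → ℝ := fun q => φ q.1 * g ((Real.sqrt θ)⁻¹ • (q.2 - u₀)) with hfdef
  have hfm : Measurable f := by
    have hc : Continuous f := by
      simp only [hfdef]
      fun_prop
    exact hc.measurable
  have hfκ : ∀ q, |f q| ≤ κ := by
    intro q
    simp only [hfdef]
    rw [abs_mul]
    calc |φ q.1| * |g ((Real.sqrt θ)⁻¹ • (q.2 - u₀))| ≤ 1 * κ :=
          mul_le_mul (hφ1 _) (hgκ _) (abs_nonneg _) zero_le_one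
      _ = κ := one_mul κ
  refine ⟨lam * ℓ, mul_pos hlam hℓ, localForecastCorrector Ψ (R * ℓ) (T * ℓ) f,
    measurable_localForecastCorrector_torus Ψ (R * ℓ) (T * ℓ) hfm, fun z => ?_, hdef⟩
  calc |localForecastCorrector Ψ (R * ℓ) (T * ℓ) f z| ≤ ((N + 1 : ℕ) : ℝ) * (T * ℓ / 2 * κ) :=
        abs_localForecastCorrector_le Ψ (R * ℓ) (mul_pos hT hℓ).le hfκ z
    _ = κ * T / 2 * ((N + 1 : ℕ) : ℝ) * ℓ := by ring

end LocalCertificateTransfer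

end Summit.AtomisticToContinuum.HydrodynamicLimit.Theorems

end
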